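import Mathlib
import HarnessLib
import Summits.ValiantsHypothesis.ValiantsHypothesis.Theorems.LacunarySymmetroidMatrixDescartesProductPlusOneRowTowerKCalculus

/-!
# LINE (A) `product_plus_one` — LOG-CONVEXITY of the θ-tower for every K: the identity for `ψ₁ψ₃ − ψ₂²`, the cloud is log-convex, the binomial law

Companion of ✓ `…RowTowerKDefs` / ✓ `…RowTowerKCalculus` (stripped row `A − Σ_l B_l x^{λ_l}`, `u = rowUK`, `H_k = rowHK`, `ψ_k = rowPsiK_k`).  The one-bump cells of
the K = 3 line (✓ `…OneBump`: a background of rows with `ψ₁ > 0`, `ψ₂² ≤ ψ₁ψ₃` against ONE bump row with `ψ₁ < 0`, `ψ₁ψ₃ < ψ₂²` ⇒ no three zeros) need,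
for every support size, exactly these per-row laws:

* §1 `rowPsiK13_sub_sq_eq` (pure identity): `ψ₁ψ₃ − ψ₂² = (H₂H₄ − H₃²)u² + (3H₂³ + H₁²H₄ − 2H₁H₂H₃)u³ + 6H₁²H₂²u⁴ + 6H₁⁴H₂u⁵ + 2H₁⁶u⁶`;
* §2 ★ `rowPsiK_logConvex_cloud`: an unswitched cloud (`B ≥ 0`, `0 < A − Σ B_l x^{λ_l}`, `x > 0`, ANY rates) has `ψ₂² ≤ ψ₁ψ₃` (Cauchy–Schwarz
  `H₃² ≤ H₂H₄` for the `u²` term, `H₂·(3H₂³ + H₁²H₄ − 2H₁H₂H₃) ≥ (H₁H₃ − H₂²)² + 2H₂⁴` for the `u³` term) and `0 ≤ ψ₁`;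
* §3 `rowPsiK13_single_eq`: a binomial row (one tail letter, any signs) has `ψ₁ψ₃ − ψ₂² = 2ψ₁³` — background (`ψ₁ > 0`) on both sides of a pole,
  bump (`ψ₁ < 0`) for a knee.
Numerics first: `lab/lc_cloud.py` (every-K clouds: 0 / 93 592 violations of `κ₂κ₄ ≥ κ₃²`; switched clouds and knee-carrying rows are NOT log-convex).

Honest framing: calculus of rows (helpers) — the every-K one-bump CELL itself is not typed here; nothing closes a stub; `OneChangeFloorK3` / `WronskianBudgetK3` /
18050 / `MatrixDescartes` OPEN; `VP ≠ VNP` NOT proved.  No definitions, no named facts.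
-/

set_option linter.dupNamespace false

namespace Summit.ValiantsHypothesis.ValiantsHypothesis.Theorems.LacunarySymmetroidMatrixDescartes

namespace ProductPlusOne

open Finset
open scoped BigOperators

variable {n : ℕ} (lam : Fin n → ℕ) (A : ℝ) (B : Fin n → ℝ)

/-! ### §1 The identity -/

/-- `ψ₁ψ₃ − ψ₂² = (H₂H₄ − H₃²)u² + (3H₂³ + H₁²H₄ − 2H₁H₂H₃)u³ + 6H₁²H₂²u⁴ + 6H₁⁴H₂u⁵ + 2H₁⁶u⁶` (pure identity). [this file's lemma] -/
theorem rowPsiK13_sub_sq_eq (x : ℝ) :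
    rowPsiK1 lam A B x * rowPsiK3 lam A B x - rowPsiK2 lam A B x ^ 2
      = (rowHK lam 2 B x * rowHK lam 4 B x - rowHK lam 3 B x ^ 2) * rowUK lam A B x ^ 2
        + (3 * rowHK lam 2 B x ^ 3 + rowHK lam 1 B x ^ 2 * rowHK lam 4 B x - 2 * rowHK lam 1 B x * rowHK lam 2 B x * rowHK lam 3 B x)
            * rowUK lam A B x ^ 3
        + 6 * rowHK lam 1 B x ^ 2 * rowHK lam 2 B x ^ 2 * rowUK lam A B x ^ 4
        + 6 * rowHK lam 1 B x ^ 4 * rowHK lam 2 B x * rowUK lam A B x ^ 5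
        + 2 * rowHK lam 1 B x ^ 6 * rowUK lam A B x ^ 6 := by
  unfold rowPsiK1 rowPsiK2 rowPsiK3
  ring

/-! ### §2 The cloud is log-convex (every K, any rates) -/

/-- Cauchy–Schwarz in the tower: `H₃² ≤ H₂·H₄` for `B ≥ 0`, `x > 0`. [this file's lemma] -/
theorem rowHK_three_sq_le {x : ℝ} (hx : 0 < x) (hB : ∀ l, 0 ≤ B l) :
    rowHK lam 3 B x ^ 2 ≤ rowHK lam 2 B x * rowHK lam 4 B x := by
  have hs : ∀ l, 0 ≤ B l * x ^ (lam l) := fun l => mul_nonneg (hB l) (pow_pos hx _).le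
  set s : Fin n → ℝ := fun l => Real.sqrt (B l * x ^ (lam l)) with hsdef
  have hs2 : ∀ l, s l ^ 2 = B l * x ^ (lam l) := fun l => Real.sq_sqrt (hs l)
  have h := Finset.sum_mul_sq_le_sq_mul_sq Finset.univ (fun l => ((lam l : ℕ) : ℝ) * s l) (fun l => ((lam l : ℕ) : ℝ) ^ 2 * s l)
  have e3 : ∑ l, ((lam l : ℕ) : ℝ) * s l * (((lam l : ℕ) : ℝ) ^ 2 * s l) = rowHK lam 3 B x := by
    unfold rowHK
    exact Finset.sum_congr rfl fun l _ => by linear_combination (((lam l : ℕ) : ℝ) ^ 3) * hs2 l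
  have e2 : ∑ l, (((lam l : ℕ) : ℝ) * s l) ^ 2 = rowHK lam 2 B x := by
    unfold rowHK
    exact Finset.sum_congr rfl fun l _ => by linear_combination (((lam l : ℕ) : ℝ) ^ 2) * hs2 l
  have e4 : ∑ l, (((lam l : ℕ) : ℝ) ^ 2 * s l) ^ 2 = rowHK lam 4 B x := by
    unfold rowHK
    exact Finset.sum_congr rfl fun l _ => by linear_combination (((lam l : ℕ) : ℝ) ^ 4) * hs2 l
  rw [e3, e2, e4] at h
  exact h

/-- The `u³` coefficient is non-negative: `0 ≤ 3H₂³ + H₁²H₄ − 2H₁H₂H₃` (`B ≥ 0`, `x > 0`). [this file's lemma] -/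
theorem rowHK_cubic_coeff_nonneg {x : ℝ} (hx : 0 < x) (hB : ∀ l, 0 ≤ B l) :
    0 ≤ 3 * rowHK lam 2 B x ^ 3 + rowHK lam 1 B x ^ 2 * rowHK lam 4 B x - 2 * rowHK lam 1 B x * rowHK lam 2 B x * rowHK lam 3 B x := by
  have h1 := rowHK_nonneg lam B 1 hx hB
  have h2 := rowHK_nonneg lam B 2 hx hB
  have h3 := rowHK_nonneg lam B 3 hx hB
  have h4 := rowHK_nonneg lam B 4 hx hB
  have hCS := rowHK_three_sq_le lam B hx hB
  rcases h2.eq_or_lt with h20 | h2pos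
  · -- `H₂ = 0` forces `H₃ = 0`
    have h30 : rowHK lam 3 B x = 0 := by
      have : rowHK lam 3 B x ^ 2 ≤ 0 := by rw [← h20, zero_mul] at hCS; exact hCS
      exact pow_eq_zero_iff (n := 2) (by norm_num) |>.1 (le_antisymm this (sq_nonneg _))
    rw [← h20, h30]
    nlinarith
  · -- multiply by `H₂ > 0`: `H₂·(…) ≥ (H₁H₃ − H₂²)² + 2H₂⁴`
    have key : rowHK lam 2 B x * (3 * rowHK lam 2 B x ^ 3 + rowHK lam 1 B x ^ 2 * rowHK lam 4 B x
        - 2 * rowHK lam 1 B x * rowHK lam 2 B x * rowHK lam 3 B x)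
        ≥ (rowHK lam 1 B x * rowHK lam 3 B x - rowHK lam 2 B x ^ 2) ^ 2 + 2 * rowHK lam 2 B x ^ 4 := by
      nlinarith [mul_le_mul_of_nonneg_left hCS (sq_nonneg (rowHK lam 1 B x))]
    by_contra hcon
    push Not at hcon
    have := mul_neg_of_pos_of_neg h2pos hcon
    nlinarith [sq_nonneg (rowHK lam 1 B x * rowHK lam 3 B x - rowHK lam 2 B x ^ 2), sq_nonneg (rowHK lam 2 B x ^ 2)]

/-- A cloud (`B ≥ 0`, unswitched, `x > 0`) has `ψ₁ ≥ 0`. [this file's lemma] -/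
theorem rowPsiK1_nonneg_cloud {x : ℝ} (hx : 0 < x) (hB : ∀ l, 0 ≤ B l) (hF : 0 < A - ∑ l, B l * x ^ (lam l)) :
    0 ≤ rowPsiK1 lam A B x := by
  have hu := rowUK_pos lam A B hF
  have h1 := rowHK_nonneg lam B 1 hx hB
  have h2 := rowHK_nonneg lam B 2 hx hB
  unfold rowPsiK1
  positivity

/-- ★ **THE CLOUD IS LOG-CONVEX, every K, any rates**: `B ≥ 0`, `0 < A − Σ B_l x^{λ_l}`, `x > 0` ⇒ `ψ₂² ≤ ψ₁ψ₃`. [this file's theorem] -/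
theorem rowPsiK_logConvex_cloud {x : ℝ} (hx : 0 < x) (hB : ∀ l, 0 ≤ B l) (hF : 0 < A - ∑ l, B l * x ^ (lam l)) :
    rowPsiK2 lam A B x ^ 2 ≤ rowPsiK1 lam A B x * rowPsiK3 lam A B x := by
  have hu := rowUK_pos lam A B hF
  have h1 := rowHK_nonneg lam B 1 hx hB
  have h2 := rowHK_nonneg lam B 2 hx hB
  have hCS := rowHK_three_sq_le lam B hx hB
  have hc3 := rowHK_cubic_coeff_nonneg lam B hx hB
  rw [← sub_nonneg, rowPsiK13_sub_sq_eq]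
  have hq : 0 ≤ (rowHK lam 2 B x * rowHK lam 4 B x - rowHK lam 3 B x ^ 2) := by linarith
  positivity

/-! ### §3 The binomial law `ψ₁ψ₃ − ψ₂² = 2ψ₁³` -/

/-- A binomial row (one tail letter `l₀`, any signs, any `x`) has `ψ₁ψ₃ − ψ₂² = 2ψ₁³` (pure identity). [this file's theorem] -/
theorem rowPsiK13_single_eq (l₀ : Fin n) (hB : ∀ l, l ≠ l₀ → B l = 0) (x : ℝ) :
    rowPsiK1 lam A B x * rowPsiK3 lam A B x - rowPsiK2 lam A B x ^ 2 = 2 * rowPsiK1 lam A B x ^ 3 := by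
  rw [rowPsiK13_sub_sq_eq]
  unfold rowPsiK1
  simp only [rowHK_single lam B l₀ hB]
  ring

end ProductPlusOne

end Summit.ValiantsHypothesis.ValiantsHypothesis.Theorems.LacunarySymmetroidMatrixDescartes
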